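import Literature.AnabelianGeometry.EtaleTheta.Setting
import Literature.AnabelianGeometry.SemiGraphs.TemperedCurves
import HarnessLib

/-!
# [EtTh] §1 setting: "`Δ_X` is a profinite free group on 2 generators" — the two tree formulations agree

Mochizuki, *The étale theta function and its Frobenioid-theoretic manifestations*, Publ. RIMS **45**
(2009), §1, PRIMS PDF p. 12 (printed 238): "Write `Π_X := (Π^tp_X)^∧`; `Δ_X := (Δ^tp_X)^∧` … `Δ_X` is
a profinite free group on 2 generators" [cite: MochizukiEtTh2009, §1 p.12].

The tree carries this printed hypothesis twice (cell abc-iut, layers L2/L3):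
* CURVE level, `EtaleTheta/Setting.lean` (seat abc-iut-L2-t1): `IsFreeProfiniteOnTwo P` — `P` is
  compact, Hausdorff, totally disconnected, and there are `a b : P` such that every pair of elements of
  a finite discrete group is the image of `(a, b)` under a unique continuous homomorphism; it is the
  field `IsEtThOrigin.deltaHat_free` of the vacuity guard;
* GROUP level, `SemiGraphs/TemperedCurves.lean` (seat abc-iut-L3-t2): `IsFreeProfiniteOn P x` for a
  family `x : ι → P` — the same universal property for families; the interface axiom
  `OncePuncturedTemperedGroup.deltaHat_free` is `∃ x : Fin 2 → Δ_X, IsFreeProfiniteOn Δ_X x`.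
This file (unit W2-L2-03, merge adapter) proves they say the same thing for `ι = Fin 2`
(`isFreeProfiniteOnTwo_iff`), so that the curve-to-group bridge of L3 ruling η (4) and the L2 guard can
be translated into each other without re-proving anything. Both formulations quantify over finite
groups in `Type`; the statement is for `P : Type`, the universe of the tree's `Π_X`.
Pure logic (`Fin 2`-indexed families versus pairs); no statement of [EtTh] is asserted.
-/

namespace Literature.AnabelianGeometry.EtaleTheta

open Literature.AnabelianGeometry.SemiGraphs

/-- **The two tree formulations of "profinite free on 2 generators" agree** ([EtTh] p. 12,
"`Δ_X` is a profinite free group on 2 generators"): the L2 guard predicate `IsFreeProfiniteOnTwo P`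
(pairs `a, b`) holds iff `P` is profinite and free on some `Fin 2`-indexed family in the sense of the L3
interface predicate `IsFreeProfiniteOn`. [cite: MochizukiEtTh2009, §1 p.12] -/
theorem isFreeProfiniteOnTwo_iff (P : Type) [Group P] [TopologicalSpace P] :
    IsFreeProfiniteOnTwo P ↔
      CompactSpace P ∧ T2Space P ∧ TotallyDisconnectedSpace P ∧
        ∃ x : Fin 2 → P, IsFreeProfiniteOn P x := by
  unfold IsFreeProfiniteOnTwo IsFreeProfiniteOn
  refine and_congr_right fun _ => and_congr_right fun _ => and_congr_right fun _ => ?_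
  constructor
  · rintro ⟨a, b, h⟩
    refine ⟨![a, b], fun F _ _ _ _ c => ?_⟩
    have h' := h F (c 0) (c 1)
    refine (existsUnique_congr fun f => ?_).mp h'
    rw [Fin.forall_fin_two]
    simp
  · rintro ⟨x, h⟩
    refine ⟨x 0, x 1, fun Q _ _ _ _ u v => ?_⟩
    have h' := h Q ![u, v]
    refine (existsUnique_congr fun f => ?_).mp h'
    rw [Fin.forall_fin_two]
    simp

/-- From the L3 group-level interface to the L2 guard: `Δ_X` of an `OncePuncturedTemperedGroup`
(a closed subgroup of the profinite `Π_X`, free on a `Fin 2`-family by the axiom `deltaHat_free`)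
satisfies `IsFreeProfiniteOnTwo` ([EtTh] p. 12). [cite: MochizukiEtTh2009, §1 p.12] -/
theorem isFreeProfiniteOnTwo_deltaHat {K : Type} [Field K] (D : OncePuncturedTemperedGroup K) :
    IsFreeProfiniteOnTwo D.deltaHat := by
  haveI : CompactSpace D.PiHat := D.isProfiniteCompletion_toHat.compactSpace
  haveI : T2Space D.PiHat := D.isProfiniteCompletion_toHat.t2Space
  haveI : TotallyDisconnectedSpace D.PiHat := D.isProfiniteCompletion_toHat.totallyDisconnectedSpace
  haveI : CompactSpace D.deltaHat := isCompact_iff_compactSpace.mp D.isClosed_deltaHat.isCompact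
  exact (isFreeProfiniteOnTwo_iff _).mpr
    ⟨inferInstance, inferInstance, inferInstance, D.deltaHat_free⟩

/-- From the L2 guard to the L3 formulation: under `IsEtThOrigin`, `Δ_X` of a `ThetaSetting` is free
on some `Fin 2`-indexed family in the sense of `IsFreeProfiniteOn` ([EtTh] p. 12).
[cite: MochizukiEtTh2009, §1 p.12] -/
theorem ThetaSetting.IsEtThOrigin.exists_isFreeProfiniteOn {p : ℕ} [Fact p.Prime]
    {D : ThetaSetting p} (h : D.IsEtThOrigin) :
    ∃ x : Fin 2 → D.DeltaHat, IsFreeProfiniteOn D.DeltaHat x :=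
  ((isFreeProfiniteOnTwo_iff _).mp h.deltaHat_free).2.2.2

end Literature.AnabelianGeometry.EtaleTheta
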